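import Summits.MatrixMultiplication.OmegaCensus.SmallFormats.MatMul22nRankGF2LowerBound
import Literature.Computability.AlgebraicComplexity.KroneckerRank
import HarnessLib

/-!
# ω-census family (a): `R_𝔽₂(⟨2,2,n⟩) = R_𝔽₂(⟨2,n,2⟩) = R_𝔽₂(⟨n,2,2⟩) = ⌈7n/2⌉` — orientations and small cases

Cell `pub-omega` (unit `pub-omega-tensor-g5`), topic `Summits/MatrixMultiplication/OmegaCensus` (sub-folder
`SmallFormats`). Framing (verbatim): lottery ticket; floor = certified bounds/negative ranges. HONEST FRAMING:
bookkeeping corollaries of the landed kernel theorem `tensorRank_matMulTensor_22n_gf2` (Hopcroft–Kerr 1971's value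
over `GF(2)`) via the orientation symmetries of the matrix multiplication tensor (Bläser 2013, Lemma 5.5, tree
`Blaser2013_lemma55`), plus the numerals for the census rows `n = 5, …, 10`. No new mathematics; nothing about `ω`.
-/

namespace Summit.MatrixMultiplication.OmegaCensus.SmallFormats

open Literature.Computability.AlgebraicComplexity

/-- `R_𝔽₂(⟨n,2,2⟩) = ⌈7n/2⌉` (Hopcroft–Kerr 1971's `p × 2` by `2 × 2` count over `GF(2)`, all `n`). -/
theorem tensorRank_matMulTensor_n22_gf2 (n : ℕ) : tensorRank (matMulTensor (ZMod 2) n 2 2) = (7 * n + 1) / 2 := by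
  rw [(Blaser2013_lemma55 (ZMod 2) n 2 2).2.1]
  exact tensorRank_matMulTensor_22n_gf2 n

/-- `R_𝔽₂(⟨2,n,2⟩) = ⌈7n/2⌉` (all `n`). -/
theorem tensorRank_matMulTensor_2n2_gf2 (n : ℕ) : tensorRank (matMulTensor (ZMod 2) 2 n 2) = (7 * n + 1) / 2 := by
  rw [(Blaser2013_lemma55 (ZMod 2) 2 n 2).1]
  exact tensorRank_matMulTensor_22n_gf2 n

/-- Census numerals: `R_𝔽₂(⟨2,2,6⟩) = 21`. -/
theorem tensorRank_matMulTensor_226_gf2 : tensorRank (matMulTensor (ZMod 2) 2 2 6) = 21 :=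
  tensorRank_matMulTensor_22n_gf2 6

/-- Census numerals: `R_𝔽₂(⟨2,2,7⟩) = 25`. -/
theorem tensorRank_matMulTensor_227_gf2 : tensorRank (matMulTensor (ZMod 2) 2 2 7) = 25 :=
  tensorRank_matMulTensor_22n_gf2 7

/-- Census numerals: `R_𝔽₂(⟨2,2,8⟩) = 28`. -/
theorem tensorRank_matMulTensor_228_gf2 : tensorRank (matMulTensor (ZMod 2) 2 2 8) = 28 :=
  tensorRank_matMulTensor_22n_gf2 8

/-- Census numerals: `R_𝔽₂(⟨2,2,9⟩) = 32`. -/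
theorem tensorRank_matMulTensor_229_gf2 : tensorRank (matMulTensor (ZMod 2) 2 2 9) = 32 :=
  tensorRank_matMulTensor_22n_gf2 9

/-- Census numerals: `R_𝔽₂(⟨2,2,10⟩) = 35`. -/
theorem tensorRank_matMulTensor_2210_gf2 : tensorRank (matMulTensor (ZMod 2) 2 2 10) = 35 :=
  tensorRank_matMulTensor_22n_gf2 10

/-- The three orientations of the census cell: `R_𝔽₂(⟨2,2,5⟩) = R_𝔽₂(⟨2,5,2⟩) = R_𝔽₂(⟨5,2,2⟩) = 18`. -/
theorem tensorRank_matMulTensor_225_252_522_gf2 :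
    tensorRank (matMulTensor (ZMod 2) 2 2 5) = 18 ∧ tensorRank (matMulTensor (ZMod 2) 2 5 2) = 18 ∧
      tensorRank (matMulTensor (ZMod 2) 5 2 2) = 18 :=
  ⟨tensorRank_matMulTensor_22n_gf2 5, tensorRank_matMulTensor_2n2_gf2 5, tensorRank_matMulTensor_n22_gf2 5⟩

end Summit.MatrixMultiplication.OmegaCensus.SmallFormats
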